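import Summits.Ventures.CertifiedArithmetic.LowPrec.SRDyadicGridProducts
import HarnessLib

/-!
# Mixed-precision product law: low-precision products SR-rounded into a wider accumulator

HONEST FRAMING: certified error envelopes and provably optimal rounding/accumulation schemes for
low-precision formats under stated cost models; every table by two implementations; no hardware or
vendor claims.

File LXXXIII of the SR slice.  LXXXI proved the PRODUCT LAW for one format: an exact product of two
format values SR-rounds back into the format with an up-probability of dyadic order at most
`max (m + 1) (bias + m − 1)`.  The common pipeline shape is MIXED: factors from formats `φ₁`, `φ₂`
(say FP8 or bfloat16), products SR-rounded into the ACCUMULATOR format `φ` (binary16 / binary32),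
then SR accumulation in `φ`.  The same structural argument gives the mixed law, with TRUNCATED
differences in place of the one-format constants:

* **`valueSet_dyadic_pUp_mul_mixed`** — for `a ∈ valueSet φ₁`, `b ∈ valueSet φ₂`,
  `pUp (valueSet φ) (a·b)` is dyadic of order `max (m₁ + m₂ + 1 − m) (j₁ + j₂ − j)` (`jᵢ = biasᵢ + mᵢ − 1`,
  `j = bias + m − 1`, truncated subtraction): the first term is the normal regime (the product's
  `m₁ + m₂ + 2` significand bits against the accumulator's `m + 1`), the second the accumulator's
  subnormal regime;
* **`valueSet_ip2_exact_mixed`** — TWO-STAGE mixed inner products (products SR-rounded into `φ` with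
  the `N`-bit model, then SR-accumulated in `φ`) are exact in law, rules `A`/`B`/`C`, once
  `N ≥ max (emaxCode − 1) (max (m₁ + m₂ + 1 − m) (j₁ + j₂ − j))`;
* closed forms: **`fp8_in_binary16_ip2_exact`** — E5M2·E5M2, E4M3·E5M2 and E4M3·E4M3 products rounded
  into binary16: `29` bits (one-stage, LXXX: `37`, `30`, `29`); **`bfloat16_in_binary32_ip_exact`** —
  bfloat16·bfloat16 products accumulated in binary32: one-stage `370` bits, two-stage `253` (the
  binary32 tree budget; the product rounding alone needs at most `117`); **`fp8_in_binary32_ip2_exact`**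
  — FP8 products in binary32: `253` (the products are exact there: order `0`).

Reading: SR-rounding the products into the accumulator format never raises the random-bit budget of
the accumulation above the accumulator's own tree budget `emaxCode − 1` for these pipelines — the
large one-stage numbers (`370`) are an artefact of feeding unrounded double-width products to the
accumulator.
-/

namespace Summit.Ventures.CertifiedArithmetic.LowPrec.SR.LimitedBits

open Literature.ComputerArithmetic.P3109
open Literature.ComputerArithmetic.ConnollyHighamMary2021
open Literature.ComputerArithmetic.FloatingPoint (Format MiniFloat)
open Literature.ComputerArithmetic.FloatingPoint.MiniFloat (valueSet valueSet_nonempty)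
open Summit.Ventures.CertifiedArithmetic.LowPrec.SR
open Finset

/-- `2^a / 2^b = 2^(a − b) / 2^(b − a)` with truncated subtraction (one of the two exponents is `0`). -/
theorem two_pow_div_two_pow (a b : ℕ) : (2 : ℚ) ^ a / 2 ^ b = 2 ^ (a - b) / 2 ^ (b - a) := by
  rcases le_total a b with h | h
  · rw [Nat.sub_eq_zero_of_le h, pow_zero, div_eq_div_iff (by positivity) (by positivity), one_mul,
      ← pow_add, Nat.add_sub_of_le h]
  · rw [Nat.sub_eq_zero_of_le h, pow_zero, div_one, div_eq_iff (by positivity), ← pow_add,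
      Nat.sub_add_cancel h]

/-! ### The mixed product law -/

/-- **The mixed product law.** For formats `φ₁`, `φ₂` (factors) and `φ` (accumulator), each with
`bias + m ≥ 1`, and format values `a ∈ valueSet φ₁`, `b ∈ valueSet φ₂`, the exact-SR up-probability
of the exact product `a·b` over `valueSet φ` is a dyadic of order at most
`max (m₁ + m₂ + 1 − m) (j₁ + j₂ − j)` (truncated differences; `jᵢ = biasᵢ + mᵢ − 1`, `j = bias + m − 1`).
With `φ₁ = φ₂ = φ` this is the product law of LXXXI (`max (m+1) j`). -/
theorem valueSet_dyadic_pUp_mul_mixed (φ φ₁ φ₂ : Format) (h : 1 ≤ φ.bias + φ.manBits)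
    (h₁ : 1 ≤ φ₁.bias + φ₁.manBits) (h₂ : 1 ≤ φ₂.bias + φ₂.manBits) {a b : ℚ}
    (ha : a ∈ valueSet φ₁) (hb : b ∈ valueSet φ₂) :
    Dyadic (max (φ₁.manBits + φ₂.manBits + 1 - φ.manBits)
        (φ₁.bias + φ₁.manBits - 1 + (φ₂.bias + φ₂.manBits - 1) - (φ.bias + φ.manBits - 1)))
      (pUp (valueSet φ) (a * b)) := by
  set j := φ.bias + φ.manBits - 1 with hj
  set j₁ := φ₁.bias + φ₁.manBits - 1 with hj₁
  set j₂ := φ₂.bias + φ₂.manBits - 1 with hj₂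
  set N := max (φ₁.manBits + φ₂.manBits + 1 - φ.manBits) (j₁ + j₂ - j) with hN
  have hF := valueSet_nonempty φ
  have hq := φ.quantum_pos
  have hqj : φ.quantum = 1 / 2 ^ j := Format.quantum_eq_inv_two_pow h
  have hqj₁ : φ₁.quantum = 1 / 2 ^ j₁ := Format.quantum_eq_inv_two_pow h₁
  have hqj₂ : φ₂.quantum = 1 / 2 ^ j₂ := Format.quantum_eq_inv_two_pow h₂
  show Dyadic N (probUp (valueSet φ) (clamp (valueSet φ) (a * b)))
  rcases clamp_eq_self_or_mem hF (a * b) with hcl | hcl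
  swap
  · -- saturating onto a value (or an exactly representable product): no rounding
    unfold probUp
    rw [roundDown_eq_self_of_mem hcl, roundUp_eq_self_of_mem hcl, sub_self, zero_div]
    exact dyadic_zero N
  rw [hcl]
  have hc : |a * b| ≤ φ.maxRat := by rw [← hcl]; exact MiniFloat.abs_clamp_valueSet_le φ (a * b)
  -- the significand structure of the product
  obtain ⟨x, rfl⟩ := MiniFloat.mem_valueSet.mp ha
  obtain ⟨y, rfl⟩ := MiniFloat.mem_valueSet.mp hb
  obtain ⟨Ma, α, hMa, hxa⟩ := MiniFloat.exists_sig_exp x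
  obtain ⟨Mb, β, hMb, hyb⟩ := MiniFloat.exists_sig_exp y
  have hr : |x.toRat * y.toRat| / φ.quantum
      = ((Ma * Mb : ℕ) : ℚ) * 2 ^ (α + β + (j - (j₁ + j₂))) / 2 ^ (j₁ + j₂ - j) := by
    have e : |x.toRat * y.toRat| / φ.quantum
        = ((Ma * Mb : ℕ) : ℚ) * 2 ^ (α + β) * (2 ^ j / 2 ^ (j₁ + j₂)) := by
      rw [abs_mul, MiniFloat.abs_toRat, MiniFloat.abs_toRat, hxa, hyb, hqj, hqj₁, hqj₂, pow_add _ j₁]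
      push_cast
      field_simp
      ring
    rw [e, two_pow_div_two_pow, pow_add _ (α + β)]
    ring
  set r := |x.toRat * y.toRat| / φ.quantum with hr_def
  set s := φ.shift ⌊r⌋.toNat with hs_def
  have hr0 : 0 ≤ r := div_nonneg (abs_nonneg _) hq.le
  -- the exponent inequality from the binade of the product
  have hexp : (j₁ + j₂ - j) + s ≤ N + (α + β + (j - (j₁ + j₂))) := by
    by_cases hs0 : s = 0
    · rw [hs0]; omega
    · have h2 := Format.two_pow_shift_le (φ := φ) hr0 (by omega)
      rw [← hs_def, hr] at h2
      have hlt : ((Ma * Mb : ℕ) : ℚ) * 2 ^ (α + β + (j - (j₁ + j₂))) / 2 ^ (j₁ + j₂ - j)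
          < 2 ^ (φ₁.manBits + 1) * 2 ^ (φ₂.manBits + 1) * 2 ^ (α + β + (j - (j₁ + j₂)))
            / 2 ^ (j₁ + j₂ - j) := by
        apply div_lt_div_of_pos_right _ (by positivity)
        apply mul_lt_mul_of_pos_right _ (by positivity)
        have : Ma * Mb < 2 ^ (φ₁.manBits + 1) * 2 ^ (φ₂.manBits + 1) :=
          mul_lt_mul'' hMa hMb (Nat.zero_le _) (Nat.zero_le _)
        exact_mod_cast this
      have h3 := lt_of_le_of_lt h2 hlt
      rw [lt_div_iff₀ (by positivity), ← pow_add, ← pow_add, ← pow_add] at h3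
      have h4 := (pow_lt_pow_iff_right₀ (by norm_num : (1 : ℚ) < 2)).mp h3
      omega
  have hcore : Dyadic N (r / 2 ^ s) := by rw [hr]; exact dyadic_sig_div hexp
  rcases MiniFloat.probUp_valueSet_trichotomy φ hc with h0 | hpos | hneg
  · rw [h0]; exact dyadic_zero N
  · rw [hpos]; exact hcore.sub_int _
  · rw [hneg]; exact hcore.int_sub _

/-! ### Two-stage mixed inner products -/

/-- **Two-stage mixed inner products.** Factors from `φ₁`, `φ₂`, products SR-rounded into the
accumulator format `φ` with the `N`-bit model, then SR-accumulated in `φ` from a start in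
`valueSet φ`: exact in law for rules `A`, `B`, `C` once
`N ≥ max (emaxCode − 1) (max (m₁ + m₂ + 1 − m) (j₁ + j₂ − j))`. -/
theorem valueSet_ip2_exact_mixed (φ φ₁ φ₂ : Format) (h : 1 ≤ φ.bias + φ.manBits)
    (h₁ : 1 ≤ φ₁.bias + φ₁.manBits) (h₂ : 1 ≤ φ₂.bias + φ₂.manBits) {N : ℕ}
    (hN : max (φ.emaxCode - 1) (max (φ₁.manBits + φ₂.manBits + 1 - φ.manBits)
        (φ₁.bias + φ₁.manBits - 1 + (φ₂.bias + φ₂.manBits - 1) - (φ.bias + φ.manBits - 1))) ≤ N)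
    {x y : ℕ → ℚ} (hx : ∀ k, x k ∈ valueSet φ₁) (hy : ∀ k, y k ∈ valueSet φ₂) {s : ℚ}
    (hs : s ∈ valueSet φ) (n : ℕ) (f : ℚ → ℚ) :
    ipExpQ (valueSet φ) (probAwayA N) (fun k => x k * y k) n f s
        = ipExp (valueSet φ) (fun k => x k * y k) n f s ∧
    ipExpQ (valueSet φ) (probAwayB N) (fun k => x k * y k) n f s
        = ipExp (valueSet φ) (fun k => x k * y k) n f s ∧
    ipExpQ (valueSet φ) (probAwayC N) (fun k => x k * y k) n f s
        = ipExp (valueSet φ) (fun k => x k * y k) n f s := by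
  have hF := valueSet_nonempty φ
  have hP : ∀ k, Dyadic N (pUp (valueSet φ) (x k * y k)) := fun k =>
    dyadic_mono ((le_max_right _ _).trans hN)
      (valueSet_dyadic_pUp_mul_mixed φ φ₁ φ₂ h h₁ h₂ (hx k) (hy k))
  have hS : ∀ a ∈ valueSet φ, ∀ b ∈ valueSet φ, Dyadic N (pUp (valueSet φ) (a + b)) :=
    fun a ha b hb => dyadic_mono ((le_max_left _ _).trans hN)
      (valueSet_dyadic_pUp φ (((valueSet_gridFormat φ).1 a ha).add ((valueSet_gridFormat φ).1 b hb)))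
  obtain ⟨hA, hB, hC⟩ := probAwayABC_of_dyadic_le (K := ℚ) (le_refl N)
  exact ⟨ipExpQ_eq_ipExp_of_tables hF hA hP hS hs n f, ipExpQ_eq_ipExp_of_tables hF hB hP hS hs n f,
    ipExpQ_eq_ipExp_of_tables hF hC hP hS hs n f⟩

/-! ### Closed forms -/

/-- **FP8 products SR-rounded into binary16, then accumulated in binary16: `29` bits** for all three
factor pairings (E5M2·E5M2 — one-stage needs `37`; E4M3·E5M2 — one-stage `30`; E4M3·E4M3 — `29`
either way, its products being exact in binary16).  The product rounding alone needs at most `8`,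
`1`, `0` bits respectively. -/
theorem fp8_in_binary16_ip2_exact {N : ℕ} (hN : 29 ≤ N) {s : ℚ} (hs : s ∈ valueSet Format.Binary16)
    (n : ℕ) (f : ℚ → ℚ) :
    (∀ {x y : ℕ → ℚ}, (∀ k, x k ∈ valueSet Format.E5M2) → (∀ k, y k ∈ valueSet Format.E5M2) →
      ipExpQ (valueSet Format.Binary16) (probAwayA N) (fun k => x k * y k) n f s
          = ipExp (valueSet Format.Binary16) (fun k => x k * y k) n f s ∧
      ipExpQ (valueSet Format.Binary16) (probAwayB N) (fun k => x k * y k) n f s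
          = ipExp (valueSet Format.Binary16) (fun k => x k * y k) n f s ∧
      ipExpQ (valueSet Format.Binary16) (probAwayC N) (fun k => x k * y k) n f s
          = ipExp (valueSet Format.Binary16) (fun k => x k * y k) n f s) ∧
    (∀ {x y : ℕ → ℚ}, (∀ k, x k ∈ valueSet Format.E4M3) → (∀ k, y k ∈ valueSet Format.E5M2) →
      ipExpQ (valueSet Format.Binary16) (probAwayA N) (fun k => x k * y k) n f s
          = ipExp (valueSet Format.Binary16) (fun k => x k * y k) n f s ∧
      ipExpQ (valueSet Format.Binary16) (probAwayB N) (fun k => x k * y k) n f s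
          = ipExp (valueSet Format.Binary16) (fun k => x k * y k) n f s ∧
      ipExpQ (valueSet Format.Binary16) (probAwayC N) (fun k => x k * y k) n f s
          = ipExp (valueSet Format.Binary16) (fun k => x k * y k) n f s) ∧
    (∀ {x y : ℕ → ℚ}, (∀ k, x k ∈ valueSet Format.E4M3) → (∀ k, y k ∈ valueSet Format.E4M3) →
      ipExpQ (valueSet Format.Binary16) (probAwayA N) (fun k => x k * y k) n f s
          = ipExp (valueSet Format.Binary16) (fun k => x k * y k) n f s ∧
      ipExpQ (valueSet Format.Binary16) (probAwayB N) (fun k => x k * y k) n f s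
          = ipExp (valueSet Format.Binary16) (fun k => x k * y k) n f s ∧
      ipExpQ (valueSet Format.Binary16) (probAwayC N) (fun k => x k * y k) n f s
          = ipExp (valueSet Format.Binary16) (fun k => x k * y k) n f s) :=
  ⟨fun hx hy => valueSet_ip2_exact_mixed _ _ _ (by decide) (by decide) (by decide)
      (le_trans (by decide) hN) hx hy hs n f,
    fun hx hy => valueSet_ip2_exact_mixed _ _ _ (by decide) (by decide) (by decide)
      (le_trans (by decide) hN) hx hy hs n f,
    fun hx hy => valueSet_ip2_exact_mixed _ _ _ (by decide) (by decide) (by decide)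
      (le_trans (by decide) hN) hx hy hs n f⟩

set_option maxRecDepth 8192 in
/-- **bfloat16 products accumulated in binary32.** One-stage (exact double-width products fed to the
binary32 SR accumulator): exact in law once `N ≥ 370 = 253 + 117` (`binary32.quantum = 2¹¹⁷ ·
bfloat16.quantum²`).  Two-stage (products first SR-rounded into binary32): `N ≥ 253`, the binary32
tree budget — the product rounding alone needs at most `max (7+7+1−23) (133+133−149) = 117` bits. -/
theorem bfloat16_in_binary32_ip_exact {x y : ℕ → ℚ} (hx : ∀ k, x k ∈ valueSet Format.BFloat16)
    (hy : ∀ k, y k ∈ valueSet Format.BFloat16) {s : ℚ} (hs : s ∈ valueSet Format.Binary32)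
    (n : ℕ) (f : ℚ → ℚ) :
    (∀ {N : ℕ}, 370 ≤ N →
      accExpQ (valueSet Format.Binary32) (probAwayA N) (fun k => x k * y k) n f s
          = accExp (valueSet Format.Binary32) (fun k => x k * y k) n f s ∧
      accExpQ (valueSet Format.Binary32) (probAwayB N) (fun k => x k * y k) n f s
          = accExp (valueSet Format.Binary32) (fun k => x k * y k) n f s ∧
      accExpQ (valueSet Format.Binary32) (probAwayC N) (fun k => x k * y k) n f s
          = accExp (valueSet Format.Binary32) (fun k => x k * y k) n f s) ∧
    (∀ {N : ℕ}, 253 ≤ N →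
      ipExpQ (valueSet Format.Binary32) (probAwayA N) (fun k => x k * y k) n f s
          = ipExp (valueSet Format.Binary32) (fun k => x k * y k) n f s ∧
      ipExpQ (valueSet Format.Binary32) (probAwayB N) (fun k => x k * y k) n f s
          = ipExp (valueSet Format.Binary32) (fun k => x k * y k) n f s ∧
      ipExpQ (valueSet Format.Binary32) (probAwayC N) (fun k => x k * y k) n f s
          = ipExp (valueSet Format.Binary32) (fun k => x k * y k) n f s) := by
  refine ⟨fun hN => valueSet_ip_exact_mixed _ _ _ 117 ?_ (le_trans (by decide) hN) hx hy hs n f,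
    fun hN => valueSet_ip2_exact_mixed _ _ _ (by decide) (by decide) (by decide)
      (le_trans (by decide) hN) hx hy hs n f⟩
  rw [Format.quantum_eq_inv_two_pow (φ := Format.Binary32) (by decide),
    Format.quantum_eq_inv_two_pow (φ := Format.BFloat16) (by decide)]
  show (1 : ℚ) / 2 ^ (127 + 23 - 1) = 2 ^ 117 * (1 / 2 ^ (127 + 7 - 1) * (1 / 2 ^ (127 + 7 - 1)))
  norm_num

set_option maxRecDepth 8192 in
/-- **FP8 products in binary32: `253` bits** (two-stage; the products of E4M3 / E5M2 values are exact
in binary32 — product-rounding order `0` — so this is just the binary32 tree budget). -/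
theorem fp8_in_binary32_ip2_exact {N : ℕ} (hN : 253 ≤ N) {s : ℚ} (hs : s ∈ valueSet Format.Binary32)
    (n : ℕ) (f : ℚ → ℚ) :
    (∀ {x y : ℕ → ℚ}, (∀ k, x k ∈ valueSet Format.E4M3) → (∀ k, y k ∈ valueSet Format.E4M3) →
      ipExpQ (valueSet Format.Binary32) (probAwayA N) (fun k => x k * y k) n f s
          = ipExp (valueSet Format.Binary32) (fun k => x k * y k) n f s ∧
      ipExpQ (valueSet Format.Binary32) (probAwayB N) (fun k => x k * y k) n f s
          = ipExp (valueSet Format.Binary32) (fun k => x k * y k) n f s ∧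
      ipExpQ (valueSet Format.Binary32) (probAwayC N) (fun k => x k * y k) n f s
          = ipExp (valueSet Format.Binary32) (fun k => x k * y k) n f s) ∧
    (∀ {x y : ℕ → ℚ}, (∀ k, x k ∈ valueSet Format.E5M2) → (∀ k, y k ∈ valueSet Format.E5M2) →
      ipExpQ (valueSet Format.Binary32) (probAwayA N) (fun k => x k * y k) n f s
          = ipExp (valueSet Format.Binary32) (fun k => x k * y k) n f s ∧
      ipExpQ (valueSet Format.Binary32) (probAwayB N) (fun k => x k * y k) n f s
          = ipExp (valueSet Format.Binary32) (fun k => x k * y k) n f s ∧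
      ipExpQ (valueSet Format.Binary32) (probAwayC N) (fun k => x k * y k) n f s
          = ipExp (valueSet Format.Binary32) (fun k => x k * y k) n f s) :=
  ⟨fun hx hy => valueSet_ip2_exact_mixed _ _ _ (by decide) (by decide) (by decide)
      (le_trans (by decide) hN) hx hy hs n f,
    fun hx hy => valueSet_ip2_exact_mixed _ _ _ (by decide) (by decide) (by decide)
      (le_trans (by decide) hN) hx hy hs n f⟩

/-- The mixed budgets instantiated (pure arithmetic, for the record): product-rounding orders
E5M2²→binary16 `8`, E4M3·E5M2→binary16 `1`, E4M3²→binary16 `0`, bfloat16²→binary32 `117`,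
E4M3²/E5M2²→binary32 `0`; two-stage thresholds `29, 29, 29, 253, 253, 253`. -/
theorem mixed_budget_values :
    max (2 + 2 + 1 - 10) (15 + 2 - 1 + (15 + 2 - 1) - (15 + 10 - 1)) = 8 ∧
    max (3 + 2 + 1 - 10) (7 + 3 - 1 + (15 + 2 - 1) - (15 + 10 - 1)) = 1 ∧
    max (3 + 3 + 1 - 10) (7 + 3 - 1 + (7 + 3 - 1) - (15 + 10 - 1)) = 0 ∧
    max (7 + 7 + 1 - 23) (127 + 7 - 1 + (127 + 7 - 1) - (127 + 23 - 1)) = 117 ∧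
    max (3 + 3 + 1 - 23) (7 + 3 - 1 + (7 + 3 - 1) - (127 + 23 - 1)) = 0 ∧
    max (2 + 2 + 1 - 23) (15 + 2 - 1 + (15 + 2 - 1) - (127 + 23 - 1)) = 0 ∧
    max (30 - 1) (max 0 8) = 29 ∧ max (254 - 1) (max 0 117) = 253 := by decide

end Summit.Ventures.CertifiedArithmetic.LowPrec.SR.LimitedBits
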